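import Mathlib
import Literature.NumberTheory.EllipticCurves.Smith2016.CongruentNumberGenusDeterminantRowFiveA
import Literature.NumberTheory.EllipticCurves.Smith2016.CongruentNumberGenusDeterminantRowsTwoThreeConsequences
import Literature.Barriers.ValiantsHypothesis.FullRankMultilinearRank

/-!
# `Σ₁(n)` odd `⟹ #Sel⁽²⁾(E⁽ⁿ⁾/ℚ) = 8` for every square-free `n ≡ 5 (mod 8)` (Smith 2016, Prop. 3.2 with row 5a)

A. Smith, *The congruent numbers have positive natural density*, arXiv:1603.08479 [Smith2016CongruentDensity],
Prop. 3.2 (chunk p0011 L58–L66): "Given `n`, and given `x ∈ {5a, 5b, 6, 7a, 7b}` agreeing with `n mod 8`,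
`ℒ_x(n)` can only be nonzero if `Sel⁽²⁾(E⁽ⁿ⁾)` has rank exactly three", proof: "If `n ≡ 5 (8)`, then the
minimal possible corank of `M₁` is one … Since `M_{5a}` and `M_{5b}` are constructed from `M₁` by adding one
row and one column, neither can have corank more than one less than that of `M₁`."  With row 5a of
Thm. 2.2 for every `k` (`CongruentNumberGenusDeterminantRowFiveA`: `ℒ_{5a}(n) = Σ₁(n) ≡ uᵀ adj(M₁) u`) this
gives, in the kernel and for every number of prime factors:

* `card_selmerGroup_two_eq_eight_of_odd_genusSum₁_five` — for `n = p₁⋯p_k ≡ 5 (mod 8)` with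
  `Σ₁(n) = Σ_{n = d₀⋯d_ℓ, dᵢ ≡ 1 (8) (i>0)} ∏ g(dᵢ)` odd, `#Sel⁽²⁾(E⁽ⁿ⁾/ℚ) = 8` (Monsky's `s(n) = 1`):
  `uᵀ adj(M₁) u ≠ 0 ⟹ adj(M₁) ≠ 0 ⟹ rank M₁ ≥ 2k − 1` (a row replacement changes the rank by at most one)
  `⟹ s(n) = 2k − rank M₁ ≤ 1`, and `s(n)` is odd (Monsky's parity theorem, tree);
* `card_selmerGroup_two_eq_eight_of_odd_genusSum₁_five'` — the same for every square-free `N ≡ 5 (mod 8)`.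
Tian–Yuan–Zhang's Theorem 1.4 (journal; not used here) draws analytic rank one from the same hypothesis;
this is its `2`-Selmer companion (`rank E⁽ⁿ⁾(ℚ) ≤ 1`, `Ш[2] ≤ ℤ/2`), with no `L`-function.
-/

namespace Literature.NumberTheory.EllipticCurves.Smith2016

open _root_.Matrix Finset Literature.LinearAlgebra.Matrix
open Literature.NumberTheory.EllipticCurves.HeathBrown1994
open Literature.NumberTheory.EllipticCurves.TianYuanZhang2017
open Literature.NumberTheory.EllipticCurves.MonskySelmerParity

section Rank

variable {m n : Type*} [Fintype n] {K : Type*} [Field K]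

omit [Fintype n] in
/-- A row replacement is a rank-one update: `A.updateRow j r = A + e_j (r − A_j)ᵀ`.
[cite: HornJohnson2013, §0.4.5 (rank of a rank-one perturbation)] -/
theorem updateRow_eq_add_vecMulVec [DecidableEq m] (A : Matrix m n K) (j : m) (r : n → K) :
    A.updateRow j r = A + vecMulVec (Pi.single j 1) (r - A j) := by
  ext a b
  rw [updateRow_apply, Matrix.add_apply, vecMulVec_apply, Pi.single_apply]
  by_cases h : a = j
  · subst h; simp
  · simp [h]

/-- **A nonzero cofactor forces corank `≤ 1`** (over `𝔽₂`): if `adj(M)_{ij} ≠ 0` then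
`card − 1 ≤ rank M` (the matrix with row `j` replaced by `eᵢ` is invertible and differs from `M` by a
rank-one matrix). [cite: HornJohnson2013, §0.8.2 (adj A ≠ 0 iff rank A ≥ n − 1) and §0.4.5] -/
theorem card_le_rank_add_one_of_adjugate_ne_zero {m : Type*} [Fintype m] [DecidableEq m]
    (M : Matrix m m (ZMod 2)) {i j : m} (h : M.adjugate i j ≠ 0) : Fintype.card m ≤ M.rank + 1 := by
  rw [adjugate_apply] at h
  have h1 : (M.updateRow j (Pi.single i 1)).det = 1 :=
    (by decide : ∀ x : ZMod 2, x ≠ 0 → x = 1) _ h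
  have hr := rank_eq_card_of_det_eq_one _ h1
  rw [updateRow_eq_add_vecMulVec] at hr
  have hle := Literature.Barriers.ValiantsHypothesis.AKV.rank_add_le' M
    (vecMulVec (Pi.single j (1 : ZMod 2)) (Pi.single i 1 - M j))
  have h1' := rank_vecMulVec_le (Pi.single j (1 : ZMod 2)) (Pi.single i 1 - M j)
  omega

end Rank

section SelmerEight

variable {k : ℕ} (p : Fin k → ℕ)

/-- **`Σ₁(n)` odd `⟹ #Sel⁽²⁾(E⁽ⁿ⁾/ℚ) = 8` for `n = p₁⋯p_k ≡ 5 (mod 8)`** (every `k`): the bordered form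
`uᵀ adj(M₁) u = ℒ_{5a}(n) = Σ₁(n)` is `1`, so `adj(M₁) ≠ 0`, `rank M₁ ≥ 2k − 1`, Monsky's `s(n) ≤ 1`; `s(n)` is
odd for `n ≡ 5 (8)`, so `s(n) = 1` and `#Sel₂ = 2^{2+1}`.
[cite: Smith2016CongruentDensity, Prop. 3.2 (chunk p0011 L58–L66) with Thm. 2.2 row 5(a)] [cite: HeathBrown1994SelmerCongruentII, Appendix (Monsky), Theorem (typescript p. 38 L5–L7) and p. 39 L27–L33] -/
theorem card_selmerGroup_two_eq_eight_of_odd_genusSum₁_five (hp : ∀ i, (p i).Prime)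
    (hodd : ∀ i, Odd (p i)) (hinj : Function.Injective p) (h8 : (∏ i, p i) % 8 = 5)
    (hodd1 : Odd (genusSum₁ (∏ i, p i) fun d => genusClassNumber (GenusField d))) :
    Nat.card ((congruentNumberCurve (∏ i, p i)).selmerGroup 2) = 8 := by
  have h4 : (∏ i, p i) % 4 = 1 := by omega
  have hp2 := ne_two_of_odd p hodd
  set M₁ := fromBlocks (legendreMatrix p + (legendreMatrix p)ᵀ) (legendreMatrix p)ᵀ (legendreMatrix p)
    (legendreDiagonal p 2) with hM₁
  set u : Fin k ⊕ Fin k → ZMod 2 :=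
    Sum.elim (fun i => addLegendreSym (-1) (p i) + addLegendreSym 2 (p i)) (0 : Fin k → ZMod 2) with hu
  have hq : u ⬝ᵥ (M₁.adjugate *ᵥ u) = 1 := by
    rw [hu, hM₁, ← genusSum₁_eq_border_adjugate_five p hp hodd hinj h8]
    exact (ZMod.natCast_eq_one_iff_odd).mpr hodd1
  have hex : ∃ i j, M₁.adjugate i j ≠ 0 := by
    by_contra hall
    push Not at hall
    have h0 : M₁.adjugate = 0 := by ext i j; exact hall i j
    rw [h0, zero_mulVec, dotProduct_zero] at hq
    exact zero_ne_one hq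
  obtain ⟨i, j, hij⟩ := hex
  have hrank := card_le_rank_add_one_of_adjugate_ne_zero M₁ hij
  rw [Fintype.card_sum, Fintype.card_fin] at hrank
  have hs := monskySelmerRankOdd_eq_sub_rank_smithMatrixOne p hp hodd hinj h4
  rw [← hM₁] at hs
  have hsodd : Odd (monskySelmerRankOdd p) :=
    (odd_monskySelmerRankOdd_iff p hp hp2 hinj).mpr (Or.inl h8)
  have hs1 : monskySelmerRankOdd p = 1 := by
    have hle : monskySelmerRankOdd p ≤ 1 := by rw [hs]; omega
    rcases Nat.le_one_iff_eq_zero_or_eq_one.mp hle with h0 | h1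
    · rw [h0] at hsodd; exact absurd hsodd (by decide)
    · exact h1
  rw [monsky_card_selmerGroup_two_odd_holds k p hp hodd hinj, hs1]
  norm_num

/-- **For every square-free `N ≡ 5 (mod 8)`: `Σ₁(N)` odd `⟹ #Sel⁽²⁾(E_N/ℚ) = 8`** (enumeration-free).
[cite: Smith2016CongruentDensity, Prop. 3.2 with Thm. 2.2 row 5(a)] [cite: TianYuanZhang2017, Thm. 1.2 / 1.4 (journal numbering; the sum Σ₁ for n ≡ 5 (8))] -/
theorem card_selmerGroup_two_eq_eight_of_odd_genusSum₁_five' {N : ℕ} (hN : Squarefree N) (h8 : N % 8 = 5)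
    (hodd1 : Odd (genusSum₁ N fun d => genusClassNumber (GenusField d))) :
    Nat.card ((congruentNumberCurve N).selmerGroup 2) = 8 := by
  obtain ⟨k, p, hp, hp2, hinj, hprod⟩ :=
    exists_odd_prime_family_of_squarefree hN (Nat.odd_iff.mpr (by omega))
  have hodd : ∀ i, Odd (p i) := fun i => (hp i).odd_of_ne_two (hp2 i)
  subst hprod
  exact card_selmerGroup_two_eq_eight_of_odd_genusSum₁_five p hp hodd hinj h8 hodd1

end SelmerEight

end Literature.NumberTheory.EllipticCurves.Smith2016
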